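import Mathlib
import Summits.Schanuel.Schanuel.Theses.RigidCore
import Literature.NumberTheory.Transcendental.ZilberFieldQuasiminimal
import Literature.NumberTheory.Transcendental.GammaFields

/-!
# Sketch — crux-ideate round 1, ideator 1, crux `RigidCore.AclSubsetLogFreeCore` (stmt-Schanuel-0968)

First lemmas of the two idea cards (`Ideas/points-not-automorphisms.md`,
`Ideas/eac-extends-core-automorphisms.md`) stated over existing declarations; nothing is proved
here (these are `def … : Prop`), the file only certifies that the statements elaborate.
-/

noncomputable section

open Literature.NumberTheory.Transcendental
open Literature.ModelTheory.ExponentialFields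

namespace Summit.Schanuel.Schanuel.Cruxes.AclSubsetLogFreeCore

/-- The log-free core `K_EA` (verbatim the route's inlined set-builder). -/
def logFreeCore : IntermediateField ℚ ℂ :=
  sInf {K : IntermediateField ℚ ℂ | (2 * ↑Real.pi * Complex.I : ℂ) ∈ K ∧
    (∀ w ∈ K, Complex.exp w ∈ K) ∧ ∀ w : ℂ, IsAlgebraic K w → w ∈ K}

/-- `acl^{ℂ_exp}(∅)` (verbatim the route's inlined set-builder). -/
def expAcl : Set ℂ :=
  {a | ∃ s : Set ℂ, s.Finite ∧ Set.Definable₁ (∅ : Set ℂ) Language.expRing s ∧ a ∈ s}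

/-- Sanity: the crux is `expAcl ⊆ logFreeCore`. -/
example : Summit.Schanuel.Schanuel.Theses.RigidCore.AclSubsetLogFreeCore ↔
    ∀ a : ℂ, a ∈ expAcl → a ∈ logFreeCore := Iff.rfl

/-! ## Card 1 — points, not automorphisms -/

/-- **Pólya's two-frequency theorem** (the only analytic input of the first lemma; Pólya 1920,
Levin *Distribution of zeros of entire functions* Ch. VI; cf. D'Aquino–Macintyre–Terzo
arXiv:1206.6747 §2): a one-variable exponential polynomial `∑ⱼ Pⱼ(z) e^{μⱼ z}` with pairwise
distinct integer frequencies and at least two non-zero polynomial coefficients has infinitely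
many complex zeros. (Literature fact to be vendored; not in the tree.) -/
def PolyaTwoFrequencies : Prop :=
  ∀ (m : ℕ) (P : Fin m → Polynomial ℂ) (μ : Fin m → ℤ), Function.Injective μ →
    2 ≤ (Finset.univ.filter fun j => P j ≠ 0).card →
    Set.Infinite {z : ℂ | ∑ j, (P j).eval z * Complex.exp ((μ j : ℂ) * z) = 0}

/-- **First lemma of card 1 (unconditional, rank-one witnesses).** If `a ∉ K_EA` and an
exponential variety `W ∩ Γ` defined over `ℚ` (the unnested body of an `∃`-formula over `∅`) has a
point `(p, eᵖ)` all of whose coordinates lie in `K_EA + ℚ·a`, with `p 0 ∉ K_EA`, then the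
projection of `W ∩ Γ` to the `0`-th coordinate is infinite. Hence no existential formula with
core-plus-rational-multiple witnesses isolates finitely many points outside the core: `(A)` holds
on that fragment. Proof sketch: write `p i = k i + n i • b` with `b = a/N`; the `K_EA`-locus of
`(b, e^b)` is the plane or an irreducible curve `F(z, w) = 0` over `K_EA` (`K_EA` is
`exp`-closed, so the fibre condition is a `K_EA`-variety containing the locus); its E-points are
all `(z, e^z)` resp. the zeros of `F(z, e^z)`, infinite by `PolyaTwoFrequencies` unless `F` has a
single frequency, in which case `b` is algebraic over `K_EA`, i.e. `b ∈ K_EA` (relative algebraic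
closedness) — contradiction. -/
def CoreUnaryWitnessesInfinite : Prop :=
  ∀ (n : ℕ) (W : Set (Fin (n + 1) ⊕ Fin (n + 1) → ℂ)),
    IsDefinedOver (⊥ : Subfield ℂ) W →
    ∀ (a : ℂ), a ∉ logFreeCore →
    ∀ (p : Fin (n + 1) → ℂ), Sum.elim p (Complex.exp ∘ p) ∈ W →
      (∀ i, ∃ k ∈ logFreeCore, ∃ q : ℚ, p i = k + (q : ℂ) * a) → p 0 ∉ logFreeCore →
      Set.Infinite {x : ℂ | ∃ y : Fin (n + 1) → ℂ, y 0 = x ∧ Sum.elim y (Complex.exp ∘ y) ∈ W}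

/-- The general existential layer of `(A)` (what card 1 reduces to `SC/K_EA ∧ EAC-density`):
every point outside the core of the projection of an exponential variety over `ℚ` is a point of
an infinite projection. -/
def ExistentialLayer : Prop :=
  ∀ (n : ℕ) (W : Set (Fin (n + 1) ⊕ Fin (n + 1) → ℂ)),
    IsDefinedOver (⊥ : Subfield ℂ) W →
    ∀ (p : Fin (n + 1) → ℂ), Sum.elim p (Complex.exp ∘ p) ∈ W → p 0 ∉ logFreeCore →
      Set.Infinite {x : ℂ | ∃ y : Fin (n + 1) → ℂ, y 0 = x ∧ Sum.elim y (Complex.exp ∘ y) ∈ W}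

/-! ## The arithmetic residue common to both cards: Schanuel OVER the core -/

/-- `SC/K_EA`: the log-free core is strong in `ℂ_exp`, `δ(x̄ / K_EA) ≥ 0` for every finite tuple
(Bays–Kirby Def. 4.3, tree `GammaField.IsStrong`). -/
def SchanuelOverLogFreeCore : Prop :=
  GammaField.IsStrong (F := ℂ) (Subalgebra.toSubmodule logFreeCore.toSubalgebra)

/-- Additivity (provable now, ~150 lines; candidate support item for the route): Schanuel's
conjecture is exactly "Schanuel inside the core" `∧` "Schanuel over the core". -/
def SchanuelSplitsOverCore : Prop :=
  _root_.Schanuel ↔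
    (Summit.Schanuel.Schanuel.Theses.RigidCore.SchanuelOnLogFreeCore ∧ SchanuelOverLogFreeCore)

/-! ## Card 2 — EAC extends automorphisms of the countable core -/

/-- **First lemma of card 2.** Exponential-algebraic closedness of `ℂ_exp` makes every E-field
automorphism of the countable core `C₀ = ecl(∅)` extend to an automorphism of `ℂ_exp` (the EAC
analogue of the tree's `KMO2012.exists_equiv_extend_eclEmpty₀` for Zilber fields; engine:
Bays–Kirby Thm 11.6 with `K = Γcl(∅)`, whose class is categorical in `𝔠` over the base, and the
base point may be twisted by `θ`). -/
def EacExtendsCoreAutomorphisms : Prop :=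
  IsExpAlgClosed ℂ →
    ∀ θ : ExponentialRingEquiv (Khovanskii.eclSubfield (∅ : Set ℂ)) (Khovanskii.eclSubfield (∅ : Set ℂ)),
      ∃ ρ : ExponentialRingEquiv ℂ ℂ, ∀ x : Khovanskii.eclSubfield (∅ : Set ℂ), ρ x = θ x

/-- Zeroth lemma of card 2 (same engine, no twisting): under EAC every `∅`-algebraic element is
exponentially algebraic, `acl(∅) ⊆ ecl(∅)` (elements outside `Γcl(∅)` are conjugate over it). -/
def EacAclSubsetEcl : Prop :=
  IsExpAlgClosed ℂ → expAcl ⊆ ecl (∅ : Set ℂ)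

/-- `(A₀)`: the residual statement about the countable E-field `C₀ = ecl(∅)` alone — every
exponentially algebraic number outside the log-free core is moved to infinitely many places by
E-automorphisms of `C₀`. -/
def CoreOrbitsInfinite : Prop :=
  ∀ a : Khovanskii.eclSubfield (∅ : Set ℂ), (a : ℂ) ∉ logFreeCore →
    Set.Infinite {b : ℂ | ∃ θ : ExponentialRingEquiv (Khovanskii.eclSubfield (∅ : Set ℂ))
      (Khovanskii.eclSubfield (∅ : Set ℂ)), ((θ a : Khovanskii.eclSubfield (∅ : Set ℂ)) : ℂ) = b}

/-- Shape of the line of card 2 (bookkeeping once the three lemmas are in: `∅`-definable sets are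
invariant under E-automorphisms of `ℂ`). -/
def CardTwoAssembly : Prop :=
  EacExtendsCoreAutomorphisms → EacAclSubsetEcl → CoreOrbitsInfinite → IsExpAlgClosed ℂ →
    Summit.Schanuel.Schanuel.Theses.RigidCore.AclSubsetLogFreeCore

end Summit.Schanuel.Schanuel.Cruxes.AclSubsetLogFreeCore
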